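import Mathlib
import HarnessLib

/-!
# SAMPLE MEANS OF I.I.D. VARIABLES DECREASE IN CONVEX ORDER:
# `E φ((h(X₁)+…+h(X_{n+1}))/(n+1)) ≥ E φ((h(X₁)+…+h(X_n))/n)` for concave `φ` — STRICTLY for
# strictly concave `φ` and non-degenerate `h(X)`

HONEST FRAMING: exact (Metropolis-corrected) sampling algorithms for lattice gauge theory;
figures of merit are autocorrelation/cost numbers at stated couplings and volumes; no
continuum-physics claim.

Venture `LatticeQCDFlow` (cell pub-lqcd), topic `Scoring`; FANOUT row 4 (`s0-u1-b`, GEN-33).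
NEW WORK of the cell (classical; not in Mathlib), no definition, nothing cited as a fact
(Hoeffding's 1963 averaging argument / the convex order of sample means is NAMED ONLY).

WHY (row 4).  The cell's fixed-batch-count / fixed-replica-count coverage limits (row 4 GEN-32
`BatchMeansFixedBatchCount`, `ReplicaMeansFixedCount`; row 13 `…ReplicaTStatisticStudent`) are
Student-type probabilities `P(|Z| ≤ q·√V_ν)` with `V_ν` the mean of `ν` squared standard normals
independent of `Z`.  Their dependence on the number of batches/replicas is governed by ONE
general fact, typed here once, Mathlib-only: for i.i.d. `X₁, X₂, …` with law `μ` and any measurable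
`h`, the sample mean of `n + 1` values `h(Xᵢ)` is SMALLER IN CONVEX ORDER than that of `n` values —
for every concave `φ`, `E φ(mean of n+1) ≥ E φ(mean of n)`, strictly when `φ` is strictly concave
and `h(X)` is non-degenerate.  Proof: the mean of `n + 1` numbers is the average of its `n + 1`
leave-one-out means (`mean_succ_eq_avg_leaveOneOut`); Jensen pointwise; each leave-one-out mean
of `n + 1` i.i.d. coordinates has the law of the mean of `n` (`measurePreserving_piFinSuccAbove`,
`measurePreserving_snd`).  Strictness: on the box `{h(x₀) ≤ a} × {b ≤ h(x₁)} × ℝ^{n−1}` (positive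
`μ^{⊗(n+1)}`-mass, `Measure.pi_pi`) two leave-one-out means differ, so strict Jensen
(`StrictConcaveOn.lt_map_sum`) makes the integrand of the difference positive there
(`integral_pos_iff_support_of_nonneg`).  The Student application is
`Scoring/GaussianStudentCountMonotone.lean`.

## Content

* `mean_succ_eq_avg_leaveOneOut` — `(Σ_{i≤n} yᵢ)/(n+1) = Σᵢ (n+1)⁻¹ · (Σ_{j} y_{succAbove i j})/n`
  (`n ≥ 1`).
* `pi_integral_leaveOneOut_eq` — `∫ g(x ∘ succAbove i) dμ^{⊗(n+1)} = ∫ g dμ^{⊗n}`.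
* `pi_integral_mean_eq_integral_avg_leaveOneOut` — `∫ φ(mean_n) dμ^{⊗n}` equals the
  `μ^{⊗(n+1)}`-integral of the average of the `n + 1` leave-one-out functionals.
* `mean_mem_of_convex` — means of values of `h` stay in a convex set containing them.
* **`pi_integral_concave_mean_mono`** — `φ` concave on a convex `s ∋ h(x)`, continuous and bounded:
  `∫ φ((Σ_{j<n} h(yⱼ))/n) dμ^{⊗n} ≤ ∫ φ((Σ_{i≤n} h(xᵢ))/(n+1)) dμ^{⊗(n+1)}` (`n ≥ 1`).
* **`pi_integral_strictConcave_mean_strictMono`** — STRICT when `φ` is strictly concave on `s` and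
  `μ{h ≤ a} > 0`, `μ{b ≤ h} > 0` for some `a < b`.

Mathlib only.  [ours] throughout.
-/

open MeasureTheory ProbabilityTheory Filter Topology Finset

namespace Summit.Ventures.LatticeQCDFlow.Scoring

section ConvexOrder

/-- **Leave-one-out averaging identity**: the mean of `n + 1` numbers is the average of the
`n + 1` leave-one-out means of `n` numbers (`n ≥ 1`). [ours] -/
theorem mean_succ_eq_avg_leaveOneOut {n : ℕ} (hn : 1 ≤ n) (y : Fin (n + 1) → ℝ) :
    (∑ i, y i) / ((n + 1 : ℕ) : ℝ)
      = ∑ i : Fin (n + 1), ((n + 1 : ℕ) : ℝ)⁻¹ * ((∑ j, y (i.succAbove j)) / (n : ℝ)) := by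
  have hn' : (n : ℝ) ≠ 0 := by exact_mod_cast (by omega : n ≠ 0)
  have hloo : ∀ i : Fin (n + 1), ∑ j, y (i.succAbove j) = (∑ k, y k) - y i := fun i => by
    rw [Fin.sum_univ_succAbove y i]; ring
  simp_rw [hloo, ← Finset.mul_sum, ← Finset.sum_div, Finset.sum_sub_distrib, Finset.sum_const,
    Finset.card_univ, Fintype.card_fin, nsmul_eq_mul]
  push_cast
  field_simp
  ring

variable {μ : Measure ℝ} [IsProbabilityMeasure μ]

/-- Each leave-one-out functional of `n + 1` i.i.d. coordinates has the expectation of the same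
functional of `n` i.i.d. coordinates (marginalising the left-out coordinate,
`measurePreserving_piFinSuccAbove`). [ours] -/
theorem pi_integral_leaveOneOut_eq {n : ℕ} {g : (Fin n → ℝ) → ℝ}
    (hg : AEStronglyMeasurable g (Measure.pi fun _ : Fin n => μ)) (i : Fin (n + 1)) :
    ∫ x, g (fun j => x (i.succAbove j)) ∂(Measure.pi fun _ : Fin (n + 1) => μ)
      = ∫ y, g y ∂(Measure.pi fun _ : Fin n => μ) := by
  have hmp := measurePreserving_piFinSuccAbove (fun _ : Fin (n + 1) => μ) i
  have h1 : ∫ x, g (fun j => x (i.succAbove j)) ∂(Measure.pi fun _ : Fin (n + 1) => μ)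
      = ∫ x, (fun p : ℝ × (Fin n → ℝ) => g p.2)
          (MeasurableEquiv.piFinSuccAbove (fun _ : Fin (n + 1) => ℝ) i x)
            ∂(Measure.pi fun _ : Fin (n + 1) => μ) := by
    rfl
  rw [h1, hmp.integral_comp' (fun p : ℝ × (Fin n → ℝ) => g p.2)]
  have hsnd : MeasurePreserving (Prod.snd : ℝ × (Fin n → ℝ) → (Fin n → ℝ))
      (μ.prod (Measure.pi fun _ : Fin n => μ)) (Measure.pi fun _ : Fin n => μ) :=
    measurePreserving_snd
  conv_rhs => rw [← hsnd.map_eq]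
  rw [integral_map measurable_snd.aemeasurable (by rwa [hsnd.map_eq])]

/-- The expectation of a functional of the mean of `n` i.i.d. copies of `h(X)` equals the
expectation of the AVERAGE of the `n + 1` leave-one-out functionals of `n + 1` copies
(`φ` continuous and bounded, `h` measurable). [ours] -/
theorem pi_integral_mean_eq_integral_avg_leaveOneOut {φ : ℝ → ℝ} (hφc : Continuous φ)
    (hφb : ∃ C, ∀ x, |φ x| ≤ C) {h : ℝ → ℝ} (hh : Measurable h) (n : ℕ) :
    ∫ y, φ ((∑ j, h (y j)) / (n : ℝ)) ∂(Measure.pi fun _ : Fin n => μ)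
      = ∫ x, ∑ i : Fin (n + 1), ((n + 1 : ℕ) : ℝ)⁻¹ *
          φ ((∑ j, h (x (i.succAbove j))) / (n : ℝ)) ∂(Measure.pi fun _ : Fin (n + 1) => μ) := by
  obtain ⟨C, hC⟩ := hφb
  have hmean_n : Measurable fun y : Fin n → ℝ => φ ((∑ j, h (y j)) / (n : ℝ)) :=
    hφc.measurable.comp ((Finset.measurable_sum _ fun j _ =>
      hh.comp (measurable_pi_apply j)).div_const _)
  have hint_loo : ∀ i : Fin (n + 1), Integrable (fun x : Fin (n + 1) → ℝ =>
      φ ((∑ j, h (x (i.succAbove j))) / (n : ℝ))) (Measure.pi fun _ : Fin (n + 1) => μ) :=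
    fun i => Integrable.of_bound (hφc.measurable.comp ((Finset.measurable_sum _ fun j _ =>
      hh.comp (measurable_pi_apply _)).div_const _)).aestronglyMeasurable C
        (ae_of_all _ fun x => hC _)
  have hloo : ∀ i : Fin (n + 1), ∫ x, φ ((∑ j, h (x (i.succAbove j))) / (n : ℝ))
        ∂(Measure.pi fun _ : Fin (n + 1) => μ)
      = ∫ y, φ ((∑ j, h (y j)) / (n : ℝ)) ∂(Measure.pi fun _ : Fin n => μ) := fun i =>
    pi_integral_leaveOneOut_eq (g := fun y : Fin n → ℝ => φ ((∑ j, h (y j)) / (n : ℝ)))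
      hmean_n.aestronglyMeasurable i
  rw [integral_finsetSum _ fun i _ => (hint_loo i).const_mul _]
  simp_rw [integral_const_mul, hloo, ← Finset.sum_mul, Finset.sum_const, Finset.card_univ,
    Fintype.card_fin, nsmul_eq_mul]
  rw [mul_inv_cancel₀ (by positivity), one_mul]

/-- A mean of `n ≥ 1` values of `h` lies in any convex set containing the values of `h`. -/
theorem mean_mem_of_convex {s : Set ℝ} (hs : Convex ℝ s) {h : ℝ → ℝ} (hhs : ∀ x, h x ∈ s)
    {n : ℕ} (hn : 1 ≤ n) {ι : Type*} (v : ι → ℝ) (e : Fin n → ι) :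
    (∑ j, h (v (e j))) / (n : ℝ) ∈ s := by
  have hn0 : (0 : ℝ) < n := by exact_mod_cast hn
  have : (∑ j, h (v (e j))) / (n : ℝ) = ∑ j : Fin n, (n : ℝ)⁻¹ • h (v (e j)) := by
    rw [Finset.sum_div]
    exact Finset.sum_congr rfl fun j _ => by rw [smul_eq_mul, div_eq_inv_mul]
  rw [this]
  refine hs.sum_mem (fun j _ => by positivity) ?_ fun j _ => hhs _
  rw [Finset.sum_const, Finset.card_univ, Fintype.card_fin, nsmul_eq_mul, mul_inv_cancel₀ hn0.ne']

/-- **SAMPLE MEANS DECREASE IN CONVEX ORDER** (weak form).  For a concave `φ` on a convex set `s`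
(continuous and bounded on `ℝ`) and a measurable `h` with values in `s`, the expectation of
`φ` of the mean of `n + 1` i.i.d. copies of `h(X)` is at least that of the mean of `n` copies
(`n ≥ 1`): leave-one-out averaging + Jensen. [ours] -/
theorem pi_integral_concave_mean_mono {s : Set ℝ} (hs : Convex ℝ s) {φ : ℝ → ℝ}
    (hφ : ConcaveOn ℝ s φ) (hφc : Continuous φ) (hφb : ∃ C, ∀ x, |φ x| ≤ C)
    {h : ℝ → ℝ} (hh : Measurable h) (hhs : ∀ x, h x ∈ s) {n : ℕ} (hn : 1 ≤ n) :
    ∫ y, φ ((∑ j, h (y j)) / (n : ℝ)) ∂(Measure.pi fun _ : Fin n => μ)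
      ≤ ∫ x, φ ((∑ i, h (x i)) / ((n + 1 : ℕ) : ℝ)) ∂(Measure.pi fun _ : Fin (n + 1) => μ) := by
  rw [pi_integral_mean_eq_integral_avg_leaveOneOut hφc hφb hh n]
  obtain ⟨C, hC⟩ := hφb
  set P := Measure.pi fun _ : Fin (n + 1) => μ with hP
  have hint_loo : ∀ i : Fin (n + 1), Integrable (fun x : Fin (n + 1) → ℝ =>
      φ ((∑ j, h (x (i.succAbove j))) / (n : ℝ))) P := fun i =>
    Integrable.of_bound (hφc.measurable.comp ((Finset.measurable_sum _ fun j _ =>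
      hh.comp (measurable_pi_apply _)).div_const _)).aestronglyMeasurable C
        (ae_of_all _ fun x => hC _)
  have hint_s : Integrable (fun x : Fin (n + 1) → ℝ =>
      φ ((∑ i, h (x i)) / ((n + 1 : ℕ) : ℝ))) P :=
    Integrable.of_bound (hφc.measurable.comp ((Finset.measurable_sum _ fun j _ =>
      hh.comp (measurable_pi_apply j)).div_const _)).aestronglyMeasurable C
        (ae_of_all _ fun x => hC _)
  refine integral_mono (integrable_finsetSum _ fun i _ => (hint_loo i).const_mul _) hint_s
    fun x => ?_
  -- pointwise Jensen along the leave-one-out decomposition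
  have hJ := hφ.le_map_sum (t := univ) (w := fun _ => ((n + 1 : ℕ) : ℝ)⁻¹)
    (p := fun i : Fin (n + 1) => (∑ j, h (x (i.succAbove j))) / (n : ℝ))
    (fun i _ => by positivity)
    (by rw [Finset.sum_const, Finset.card_univ, Fintype.card_fin, nsmul_eq_mul,
          mul_inv_cancel₀ (by positivity)])
    fun i _ => mean_mem_of_convex hs hhs hn x i.succAbove
  simp only [smul_eq_mul] at hJ
  rw [← mean_succ_eq_avg_leaveOneOut hn (fun i => h (x i))] at hJ
  exact hJ

/-- **SAMPLE MEANS STRICTLY DECREASE IN CONVEX ORDER**.  If moreover `φ` is STRICTLY concave on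
`s` and `h(X)` is non-degenerate in the sense that `h ≤ a` and `b ≤ h` (`a < b`) both have
positive probability, the inequality is strict (`n ≥ 1`). [ours] -/
theorem pi_integral_strictConcave_mean_strictMono {s : Set ℝ} (hs : Convex ℝ s) {φ : ℝ → ℝ}
    (hφ : StrictConcaveOn ℝ s φ) (hφc : Continuous φ) (hφb : ∃ C, ∀ x, |φ x| ≤ C)
    {h : ℝ → ℝ} (hh : Measurable h) (hhs : ∀ x, h x ∈ s)
    (hnd : ∃ a b : ℝ, a < b ∧ 0 < μ {x | h x ≤ a} ∧ 0 < μ {x | b ≤ h x}) {n : ℕ} (hn : 1 ≤ n) :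
    ∫ y, φ ((∑ j, h (y j)) / (n : ℝ)) ∂(Measure.pi fun _ : Fin n => μ)
      < ∫ x, φ ((∑ i, h (x i)) / ((n + 1 : ℕ) : ℝ)) ∂(Measure.pi fun _ : Fin (n + 1) => μ) := by
  rw [pi_integral_mean_eq_integral_avg_leaveOneOut hφc hφb hh n]
  obtain ⟨C, hC⟩ := hφb
  obtain ⟨a, b, hab, ha, hb⟩ := hnd
  set P := Measure.pi fun _ : Fin (n + 1) => μ with hP
  have hn0 : (0 : ℝ) < n := by exact_mod_cast hn
  have hint_loo : ∀ i : Fin (n + 1), Integrable (fun x : Fin (n + 1) → ℝ =>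
      φ ((∑ j, h (x (i.succAbove j))) / (n : ℝ))) P := fun i =>
    Integrable.of_bound (hφc.measurable.comp ((Finset.measurable_sum _ fun j _ =>
      hh.comp (measurable_pi_apply _)).div_const _)).aestronglyMeasurable C
        (ae_of_all _ fun x => hC _)
  have hint_s : Integrable (fun x : Fin (n + 1) → ℝ =>
      φ ((∑ i, h (x i)) / ((n + 1 : ℕ) : ℝ))) P :=
    Integrable.of_bound (hφc.measurable.comp ((Finset.measurable_sum _ fun j _ =>
      hh.comp (measurable_pi_apply j)).div_const _)).aestronglyMeasurable C
        (ae_of_all _ fun x => hC _)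
  rw [← sub_pos,
    ← integral_sub hint_s (integrable_finsetSum _ fun i _ => (hint_loo i).const_mul _)]
  -- the difference is pointwise nonnegative (Jensen) ...
  have hw1 : ∑ _i : Fin (n + 1), ((n + 1 : ℕ) : ℝ)⁻¹ = 1 := by
    rw [Finset.sum_const, Finset.card_univ, Fintype.card_fin, nsmul_eq_mul,
      mul_inv_cancel₀ (by positivity)]
  have hnonneg : ∀ x : Fin (n + 1) → ℝ, 0 ≤ φ ((∑ i, h (x i)) / ((n + 1 : ℕ) : ℝ))
      - ∑ i : Fin (n + 1), ((n + 1 : ℕ) : ℝ)⁻¹ * φ ((∑ j, h (x (i.succAbove j))) / (n : ℝ)) := by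
    intro x
    have hJ := hφ.concaveOn.le_map_sum (t := univ) (w := fun _ => ((n + 1 : ℕ) : ℝ)⁻¹)
      (p := fun i : Fin (n + 1) => (∑ j, h (x (i.succAbove j))) / (n : ℝ))
      (fun i _ => by positivity) hw1 fun i _ => mean_mem_of_convex hs hhs hn x i.succAbove
    simp only [smul_eq_mul] at hJ
    rw [← mean_succ_eq_avg_leaveOneOut hn (fun i => h (x i))] at hJ
    linarith
  rw [integral_pos_iff_support_of_nonneg hnonneg
    (hint_s.sub (integrable_finsetSum _ fun i _ => (hint_loo i).const_mul _))]
  -- ... and strictly positive on the box `{h(x₀) ≤ a} × {b ≤ h(x₁)} × ℝ^{n−1}`, of positive mass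
  set i₀ : Fin (n + 1) := ⟨0, by omega⟩ with hi₀
  set i₁ : Fin (n + 1) := ⟨1, by omega⟩ with hi₁
  have h01 : i₀ ≠ i₁ := by simp [hi₀, hi₁, Fin.ext_iff]
  set B : Fin (n + 1) → Set ℝ := fun i =>
    if i = i₀ then {x | h x ≤ a} else if i = i₁ then {x | b ≤ h x} else Set.univ with hB
  have hbox : 0 < P (Set.univ.pi B) := by
    rw [hP, Measure.pi_pi]
    refine pos_iff_ne_zero.2 (Finset.prod_ne_zero_iff.2 fun i _ => ?_)
    by_cases h0 : i = i₀
    · simp only [hB, h0, if_true]; exact ha.ne'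
    · by_cases h1 : i = i₁
      · simp only [hB, h1, h01.symm, if_false, if_true]; exact hb.ne'
      · simp only [hB, h0, h1, if_false, measure_univ]; exact one_ne_zero
  refine lt_of_lt_of_le hbox (measure_mono fun x hx => ?_)
  rw [Function.mem_support]
  have hx0 : h (x i₀) ≤ a := by
    have := hx i₀ (Set.mem_univ _); simpa [hB] using this
  have hx1 : b ≤ h (x i₁) := by
    have := hx i₁ (Set.mem_univ _); simpa [hB, h01.symm] using this
  have hne : (∑ j, h (x (i₀.succAbove j))) / (n : ℝ)
      ≠ (∑ j, h (x (i₁.succAbove j))) / (n : ℝ) := by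
    have hl : ∀ i : Fin (n + 1), ∑ j, h (x (i.succAbove j)) = (∑ k, h (x k)) - h (x i) :=
      fun i => by rw [Fin.sum_univ_succAbove (fun k => h (x k)) i]; ring
    rw [hl, hl, Ne, div_left_inj' hn0.ne']
    intro heq
    have : h (x i₀) = h (x i₁) := by linarith
    linarith
  have hJ := hφ.lt_map_sum (t := univ) (w := fun _ => ((n + 1 : ℕ) : ℝ)⁻¹)
    (p := fun i : Fin (n + 1) => (∑ j, h (x (i.succAbove j))) / (n : ℝ))
    (fun i _ => by positivity) hw1 (fun i _ => mean_mem_of_convex hs hhs hn x i.succAbove)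
    ⟨i₀, Finset.mem_univ _, i₁, Finset.mem_univ _, hne⟩
  simp only [smul_eq_mul] at hJ
  rw [← mean_succ_eq_avg_leaveOneOut hn (fun i => h (x i))] at hJ
  exact (sub_pos.2 hJ).ne'

end ConvexOrder

end Summit.Ventures.LatticeQCDFlow.Scoring
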